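import Mathlib.LinearAlgebra.Matrix.SchurComplement
import Mathlib.Logic.Equiv.Fin.Basic
import Literature.Computability.AlgebraicComplexity.DeterminantalComplexityProofs
import Literature.Computability.AlgebraicComplexity.LRPencilOfMatrix

/-!
# `DetqpThesis` (stmt-ValiantsHypothesis-0315), line `chow-rank-ladder` — stub S1:
# linearisation of the rank-`r` permanent

The rank-`r` permanent is `P n r := per_n (U Vᵀ)`, i.e. the generic permanent `perPoly (Fin n) ℂ`
with the variable `x_{ij}` replaced by the bilinear form `Σ_a U_{ia} V_{ja}`, where
`U_{ia} = X (inl (i, a))` and `V_{ja} = X (inr (j, a))` are `2nr` fresh variables.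

`stub_linearisation`: `dc (P n r) ≤ (1 + r n²) · dc (per_n)`.

Proof (pure bookkeeping, valid for every polynomial in place of `per_n` and every bilinear
substitution `x_e ↦ Σ_a X (u e a) · X (w e a)`, `hasDetRepr_aeval_sum_X_mul_X`): take an affine
determinantal representation `f = det A` of size `m` attaining `dc f`
(`hasDetRepr_determinantalComplexity_holds`), write every entry as
`A i j = c₀ + Σ_e c_e x_e` (`LRPencil.eq_affine_of_totalDegree_le_one`), and consider the block
matrix `B = [[A₀, 𝕌], [-𝕍, 1]]` indexed by `Fin m ⊕ (σ × α) × Fin m` with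
`𝕌 i ((e, a), l) = c_e(A i l) · X (u e a)` and `𝕍 ((e, a), l) j = [l = j] · X (w e a)`.  Its entries
are affine, and by the Schur complement formula (`Matrix.det_fromBlocks_one₂₂`)
`det B = det (A₀ + 𝕌 𝕍) = det (A (x ↦ Σ_a X (u e a) X (w e a))) = f (x ↦ …)` (`AlgHom.map_det`).
Reindexing to `Fin ((1 + |α| |σ|) m)` (`Matrix.det_reindex_self`) gives the representation.

Sources: folklore (linearisation of quadratic entries through a Schur complement); T. Mignon,
N. Ressayre, *A quadratic bound for the determinant and permanent problem*, IMRN 2004, §1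
(affine determinantal representations).
-/

-- single-conjunct layout: Sub = Summit, duplicated namespace component intended
set_option linter.dupNamespace false

noncomputable section

namespace Summit.ValiantsHypothesis.ValiantsHypothesis.Theorems.DetQPDetqpThesis.ChowRankLinearisation

open MvPolynomial
open Literature.Computability.AlgebraicComplexity

section General

variable {k : Type*} [CommRing k] {σ τ α ι : Type*}

/-- `C c * X v` has total degree `≤ 1` (over any commutative ring; a variable is homogeneous of
degree `1`, `MvPolynomial.isHomogeneous_X`). [folklore] -/
theorem totalDegree_C_mul_X_le_one (c : k) (v : τ) :
    (C c * X v : MvPolynomial τ k).totalDegree ≤ 1 := by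
  refine (totalDegree_mul _ _).trans ?_
  rw [totalDegree_C, zero_add]
  exact (isHomogeneous_X k v).totalDegree_le

variable [Fintype σ]

/-- Substitution into an affine polynomial: if `p = c₀ + Σ_e c_e x_e` then
`p(φ) = c₀ + Σ_e c_e φ_e`. [folklore] -/
theorem aeval_eq_of_totalDegree_le_one (φ : σ → MvPolynomial τ k) (p : MvPolynomial σ k)
    (hp : p.totalDegree ≤ 1) :
    aeval φ p = C (coeff 0 p) + ∑ e, C (coeff (Finsupp.single e 1) p) * φ e := by
  conv_lhs => rw [LRPencil.eq_affine_of_totalDegree_le_one p hp]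
  simp only [map_add, map_sum, map_mul, aeval_C, aeval_X, algebraMap_eq]

variable [Fintype α] [Fintype ι] [DecidableEq ι]

/-- The product of the two off-diagonal blocks of the linearisation matrix:
`(𝕌 𝕍) i j = Σ_e c_e(A i j) · Σ_a X (u e a) X (w e a)`. [folklore] -/
theorem linBlock_mul_apply (A : Matrix ι ι (MvPolynomial σ k)) (u w : σ → α → τ) (i j : ι) :
    ((Matrix.of fun (i : ι) (q : (σ × α) × ι) =>
        (C (coeff (Finsupp.single q.1.1 1) (A i q.2)) * X (u q.1.1 q.1.2) : MvPolynomial τ k)) *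
      Matrix.of fun (q : (σ × α) × ι) (j : ι) =>
        (if q.2 = j then X (w q.1.1 q.1.2) else 0 : MvPolynomial τ k)) i j =
    ∑ e, C (coeff (Finsupp.single e 1) (A i j)) * ∑ a, X (u e a) * X (w e a) := by
  simp only [Matrix.mul_apply, Matrix.of_apply, Fintype.sum_prod_type, mul_ite, mul_zero,
    Finset.sum_ite_eq', Finset.mem_univ, if_true, Finset.mul_sum, mul_assoc]

variable [DecidableEq σ] [DecidableEq α]

/-- **The linearisation matrix.** For an affine matrix `A = A₀ + Σ_e x_e A_e` and a bilinear
substitution `x_e ↦ Σ_a X (u e a) X (w e a)`, the block matrix `[[A₀, 𝕌], [-𝕍, 1]]` with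
`𝕌 i ((e, a), l) = (A_e) i l · X (u e a)`, `𝕍 ((e, a), l) j = [l = j] · X (w e a)` has affine
entries and determinant `det (A₀ + 𝕌 𝕍) = (det A)(x ↦ Σ_a X (u e a) X (w e a))`
(`Matrix.det_fromBlocks_one₂₂`, `AlgHom.map_det`). [folklore] -/
theorem exists_linBlockMatrix (A : Matrix ι ι (MvPolynomial σ k))
    (hA : ∀ i j, (A i j).totalDegree ≤ 1) (u w : σ → α → τ) :
    ∃ B : Matrix (ι ⊕ (σ × α) × ι) (ι ⊕ (σ × α) × ι) (MvPolynomial τ k),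
      (∀ p q, (B p q).totalDegree ≤ 1) ∧
        B.det = aeval (fun e => ∑ a, X (u e a) * X (w e a)) A.det := by
  refine ⟨Matrix.fromBlocks ((Matrix.of fun i j => coeff 0 (A i j)).map C)
    (Matrix.of fun (i : ι) (q : (σ × α) × ι) =>
      (C (coeff (Finsupp.single q.1.1 1) (A i q.2)) * X (u q.1.1 q.1.2) : MvPolynomial τ k))
    (-Matrix.of fun (q : (σ × α) × ι) (j : ι) =>
      (if q.2 = j then X (w q.1.1 q.1.2) else 0 : MvPolynomial τ k))
    1, ?_, ?_⟩
  · rintro (i | p) (j | q)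
    · simp only [Matrix.fromBlocks_apply₁₁, Matrix.map_apply, Matrix.of_apply, totalDegree_C]
      exact Nat.zero_le _
    · simp only [Matrix.fromBlocks_apply₁₂, Matrix.of_apply]
      exact totalDegree_C_mul_X_le_one _ _
    · simp only [Matrix.fromBlocks_apply₂₁, Matrix.neg_apply, Matrix.of_apply, totalDegree_neg]
      split_ifs
      · exact (isHomogeneous_X k _).totalDegree_le
      · simp only [totalDegree_zero]
        exact Nat.zero_le _
    · simp only [Matrix.fromBlocks_apply₂₂, Matrix.one_apply]
      split_ifs
      · simp only [totalDegree_one]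
        exact Nat.zero_le _
      · simp only [totalDegree_zero]
        exact Nat.zero_le _
  · rw [Matrix.det_fromBlocks_one₂₂, Matrix.mul_neg, sub_neg_eq_add, AlgHom.map_det,
      AlgHom.mapMatrix_apply]
    congr 1
    ext i j
    rw [Matrix.add_apply, Matrix.map_apply, Matrix.map_apply, Matrix.of_apply,
      aeval_eq_of_totalDegree_le_one _ (A i j) (hA i j), linBlock_mul_apply]

/-- **Linearisation of a bilinear substitution.** If `f` has an affine determinantal
representation of size `m`, then `f (x_e ↦ Σ_{a : α} X (u e a) · X (w e a))` has one of size
`m + |σ| |α| m` (the linearisation matrix `exists_linBlockMatrix`, reindexed to `Fin`).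
[folklore] -/
theorem hasDetRepr_aeval_sum_X_mul_X {f : MvPolynomial σ k} {m : ℕ} (h : HasDetRepr f m)
    (u w : σ → α → τ) :
    HasDetRepr (aeval (fun e => ∑ a, X (u e a) * X (w e a) : σ → MvPolynomial τ k) f)
      (Fintype.card (Fin m ⊕ (σ × α) × Fin m)) := by
  obtain ⟨A, hA, rfl⟩ := h
  obtain ⟨B, hB, hdet⟩ := exists_linBlockMatrix A hA u w
  exact ⟨Matrix.reindex (Fintype.equivFin _) (Fintype.equivFin _) B,
    fun i j => by rw [Matrix.reindex_apply, Matrix.submatrix_apply]; exact hB _ _,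
    by rw [Matrix.det_reindex_self, hdet]⟩

end General

/-- **Stub S1 of line `chow-rank-ladder` — LINEARISATION.**  For the rank-`r` permanent
`P n r = per_n (U Vᵀ)` (the generic permanent with `x_{ij} ↦ Σ_a U_{ia} V_{ja}`,
`U_{ia} = X (inl (i, a))`, `V_{ja} = X (inr (j, a))`):
`dc (P n r) ≤ (1 + r n²) · dc (per_n)`.  Substitute into an attained affine representation of
`per_n` (`hasDetRepr_determinantalComplexity_holds`) and linearise the bilinear entries through
the block matrix `[[A₀, 𝕌], [-𝕍, 1]]` of size `m + n² r m` (`hasDetRepr_aeval_sum_X_mul_X`).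
It is a transfer lemma: it holds verbatim for every polynomial in place of `per_n`. [folklore] -/
theorem stub_linearisation : ∀ n r : ℕ,
    determinantalComplexity (aeval (fun p : Fin n × Fin n => ∑ a : Fin r,
      (X (Sum.inl (p.1, a)) * X (Sum.inr (p.2, a)) : MvPolynomial ((Fin n × Fin r) ⊕ (Fin n × Fin r)) ℂ))
      (perPoly (Fin n) ℂ))
    ≤ (1 + r * n ^ 2) * determinantalComplexity (perPoly (Fin n) ℂ) := by
  intro n r
  have h := hasDetRepr_aeval_sum_X_mul_X (α := Fin r)
    (hasDetRepr_determinantalComplexity_holds (perPoly (Fin n) ℂ))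
    (fun (p : Fin n × Fin n) (a : Fin r) =>
      (Sum.inl (p.1, a) : (Fin n × Fin r) ⊕ (Fin n × Fin r)))
    (fun (p : Fin n × Fin n) (a : Fin r) =>
      (Sum.inr (p.2, a) : (Fin n × Fin r) ⊕ (Fin n × Fin r)))
  refine (determinantalComplexity_le_of_hasDetRepr h).trans_eq ?_
  simp only [Fintype.card_sum, Fintype.card_prod, Fintype.card_fin]
  ring

end Summit.ValiantsHypothesis.ValiantsHypothesis.Theorems.DetQPDetqpThesis.ChowRankLinearisation

end
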